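import Mathlib.LinearAlgebra.FreeModule.Finite.CardQuotient
import Mathlib.LinearAlgebra.Matrix.ToLinearEquiv
import Mathlib.Algebra.Ring.Pi
import Mathlib.Data.ZMod.Basic
import Mathlib.GroupTheory.Index
import Mathlib.GroupTheory.QuotientGroup.Basic
import HarnessLib

/-!
# `#ker(A mod M) = |det A|` for an integer matrix `A` with `M ℤ^ι ⊆ A ℤ^ι`

Topic `Literature/LinearAlgebra/FreeModule`; namespace `Literature.LinearAlgebra.FreeModule`.  THEOREMS ONLY (no
definition, no named fact, no instance).  The `ℤ`-instance of "the order of the cokernel of an injective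
endomorphism of a finite free module is its determinant" (Stacks 02QG; Mathlib `Submodule.natAbs_det_equiv`,
`AddSubgroup.index_eq_natAbs_det`), read on the KERNEL of the reduction modulo `M`:

* `natCard_quotient_range_mulVecLin_eq_natAbs_det` — **`#(ℤ^ι ⧸ A ℤ^ι) = |det A|`** for `A ∈ M_ι(ℤ)` with `det A ≠ 0`;
* (private) `natCard_ker_eq_index_range` — for an endomorphism `f` of a finite abelian group, `#ker f = [G : f(G)]`;
* `natCard_ker_mulVec_zmod_eq_natAbs_det` — **`#{c ∈ (ℤ/M)^ι : Ā c = 0} = |det A|`** whenever `A B = M·1` for some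
  integral `B` (equivalently `M ℤ^ι ⊆ A ℤ^ι`): the kernel of `Ā = A mod M` has the order of the cokernel of `Ā`, which is
  `ℤ^ι ⧸ (A ℤ^ι + M ℤ^ι) = ℤ^ι ⧸ A ℤ^ι`;
* `natCard_ker_mulVec_mul_eq_of_isUnit`, `natCard_ker_mulVec_mul_zmod_eq_natAbs_det` — the same kernel after an
  invertible change of coordinates `R` (`#ker(Ā R) = #ker Ā`).

Sanity: `A = (2)`: `M = 4` (`B = (2)`) gives `ker(2̄ : ℤ/4) = {0, 2}` of order `2 = det A`; for `M = 3` there is no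
integral `B` and indeed `ker(2̄ : ℤ/3) = 0`.

This is the counting lemma behind the order `ν^g` of the kernel of a Hecke isogeny quotient (an integral symplectic
similitude `γ` of multiplier `ν` has `γ γ⋆ = ν·1` and `|det γ| = ν^g`, [ShimuraIATAF1971] §3.2 «det β = b»; the Hecke
kernel is `ker(γ̄ mod Nν)`), cell hodgecm-mathlib (D-0151), seat B-p15 (g10); the instance lives in
`AlgebraicGeometry/ModuliOfAbelianVarieties/SiegelHeckeKernelCard`.

## References

* [StacksProject] The Stacks Project, Tag 02QE (length of the cokernel = order of the determinant).
* [ShimuraIATAF1971] G. Shimura, *Introduction to the Arithmetic Theory of Automorphic Functions* (1971), §3.2.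
-/

open Matrix

namespace Literature.LinearAlgebra.FreeModule

variable {ι : Type*} [Fintype ι] [DecidableEq ι]

/-! ### §1 The cokernel of an integer matrix -/

/-- A square integer matrix with non-zero determinant acts injectively on `ℤ^ι` (Mathlib
`Matrix.exists_mulVec_eq_zero_iff` over the domain `ℤ`). [folklore] -/
private theorem mulVecLin_injective_of_det_ne_zero (A : Matrix ι ι ℤ) (hA : A.det ≠ 0) :
    Function.Injective A.mulVecLin := by
  rw [← LinearMap.ker_eq_bot, LinearMap.ker_eq_bot']
  intro v hv
  by_contra hv0
  exact hA (Matrix.exists_mulVec_eq_zero_iff.mp ⟨v, hv0, by simpa using hv⟩)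

/-- **`#(ℤ^ι ⧸ A ℤ^ι) = |det A|`** for a square integer matrix `A` with `det A ≠ 0`
(Mathlib `Submodule.natAbs_det_equiv` with the isomorphism `ℤ^ι ≃ A ℤ^ι`). [cite: StacksProject, Tag 02QE] -/
theorem natCard_quotient_range_mulVecLin_eq_natAbs_det (A : Matrix ι ι ℤ) (hA : A.det ≠ 0) :
    Nat.card ((ι → ℤ) ⧸ LinearMap.range A.mulVecLin) = A.det.natAbs := by
  let e : (ι → ℤ) ≃ₗ[ℤ] LinearMap.range A.mulVecLin :=
    LinearEquiv.ofInjective A.mulVecLin (mulVecLin_injective_of_det_ne_zero A hA)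
  have h := Submodule.natAbs_det_equiv (LinearMap.range A.mulVecLin) e
  have hcomp : (LinearMap.range A.mulVecLin).subtype ∘ₗ
      ((e : (ι → ℤ) →+ LinearMap.range A.mulVecLin)).toIntLinearMap = A.mulVecLin := by
    refine LinearMap.ext fun v => ?_
    change ((e v : LinearMap.range A.mulVecLin) : ι → ℤ) = A.mulVecLin v
    exact LinearEquiv.ofInjective_apply _ _
  rw [hcomp, ← Matrix.toLin'_apply', LinearMap.det_toLin'] at h
  exact h.symm

/-! ### §2 Kernel versus cokernel in a finite abelian group -/

/-- For an endomorphism `f` of a finite abelian group `G`, **`#ker f = [G : f(G)]`** (`#G = #ker f · #f(G)` and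
`#G = [G : f(G)] · #f(G)`). [folklore] -/
private theorem natCard_ker_eq_index_range {G : Type*} [AddCommGroup G] [Finite G] (f : G →+ G) :
    Nat.card f.ker = f.range.index := by
  have h1 : Nat.card f.ker * f.ker.index = Nat.card G := f.ker.card_mul_index
  have h2 : f.range.index * Nat.card f.range = Nat.card G := f.range.index_mul_card
  have h3 : f.ker.index = Nat.card f.range :=
    Nat.card_congr (QuotientAddGroup.quotientKerEquivRange f).toEquiv
  have hpos : 0 < Nat.card f.range := Nat.card_pos
  rw [h3] at h1
  exact Nat.eq_of_mul_eq_mul_right hpos (h1.trans h2.symm)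

/-! ### §3 The kernel modulo `M` -/

/-- **`#{c ∈ (ℤ/M)^ι : Ā c = 0} = |det A|`** for an integer matrix `A` with `A B = M·1` for some integral `B`
(`M ≠ 0`): the reduction `π : ℤ^ι → (ℤ/M)^ι` has kernel `M ℤ^ι = A(B ℤ^ι) ⊆ A ℤ^ι`, so `Ā((ℤ/M)^ι) = π(A ℤ^ι)` has index
`[ℤ^ι : A ℤ^ι] = |det A|`, and in the finite group `(ℤ/M)^ι` the kernel of `Ā` has the order of its cokernel.
[cite: StacksProject, Tag 02QE] -/
theorem natCard_ker_mulVec_zmod_eq_natAbs_det {M : ℕ} [NeZero M] (A B : Matrix ι ι ℤ)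
    (hAB : A * B = (M : ℤ) • (1 : Matrix ι ι ℤ)) :
    Nat.card {c : ι → ZMod M // A.map (Int.castRingHom (ZMod M)) *ᵥ c = 0} = A.det.natAbs := by
  classical
  -- `det A ≠ 0`
  have hM : (M : ℤ) ≠ 0 := by exact_mod_cast NeZero.ne M
  have hdet : A.det ≠ 0 := by
    have h := congrArg Matrix.det hAB
    rw [Matrix.det_mul, Matrix.det_smul, Matrix.det_one, mul_one] at h
    intro h0
    rw [h0, zero_mul] at h
    exact pow_ne_zero _ hM h.symm
  -- the reduction `π : ℤ^ι → (ℤ/M)^ι`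
  let π : (ι → ℤ) →+* (ι → ZMod M) := (Int.castRingHom (ZMod M)).compLeft ι
  have hπ : ∀ x : ι → ℤ, π x = (Int.castRingHom (ZMod M)) ∘ x := fun _ => rfl
  have hπs : Function.Surjective π := fun c => by
    obtain ⟨x, hx⟩ := (ZMod.intCast_surjective (n := M)).comp_left c
    exact ⟨x, hx⟩
  -- `Ā` as an endomorphism of `(ℤ/M)^ι`, and `Ā ∘ π = π ∘ A`
  let f : (ι → ZMod M) →+ (ι → ZMod M) := (A.map (Int.castRingHom (ZMod M))).mulVecLin.toAddMonoidHom
  have hf : ∀ c, f c = A.map (Int.castRingHom (ZMod M)) *ᵥ c := fun _ => rfl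
  have hfπ : ∀ x : ι → ℤ, f (π x) = π (A *ᵥ x) := by
    intro x
    rw [hf, hπ, hπ]
    funext i
    exact (RingHom.map_mulVec (Int.castRingHom (ZMod M)) A x i).symm
  -- `f((ℤ/M)^ι) = π(A ℤ^ι)`
  have hrange : f.range = ((LinearMap.range A.mulVecLin).toAddSubgroup).map (π : (ι → ℤ) →+ (ι → ZMod M)) := by
    ext c
    constructor
    · rintro ⟨y, rfl⟩
      obtain ⟨x, rfl⟩ := hπs y
      exact ⟨A *ᵥ x, ⟨x, rfl⟩, (hfπ x).symm⟩
    · rintro ⟨y, ⟨x, hx⟩, rfl⟩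
      refine ⟨π x, ?_⟩
      rw [hfπ, ← hx]
      rfl
  -- `ker π = M ℤ^ι ⊆ A ℤ^ι`
  have hker : (π : (ι → ℤ) →+ (ι → ZMod M)).ker ≤ (LinearMap.range A.mulVecLin).toAddSubgroup := by
    intro x hx
    rw [AddMonoidHom.mem_ker] at hx
    have hdvd : ∀ i, (M : ℤ) ∣ x i := fun i =>
      (ZMod.intCast_zmod_eq_zero_iff_dvd (x i) M).1 (by
        have := congrFun hx i
        exact this)
    choose y hy using hdvd
    refine ⟨B *ᵥ y, ?_⟩
    change A *ᵥ (B *ᵥ y) = x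
    rw [Matrix.mulVec_mulVec, hAB, Matrix.smul_mulVec, Matrix.one_mulVec]
    funext i
    rw [Pi.smul_apply, smul_eq_mul, hy i]
  -- count
  have hset : Nat.card {c : ι → ZMod M // A.map (Int.castRingHom (ZMod M)) *ᵥ c = 0} = Nat.card f.ker :=
    Nat.card_congr (Equiv.subtypeEquivRight fun c => by rw [AddMonoidHom.mem_ker, hf])
  rw [hset, natCard_ker_eq_index_range f, hrange, AddSubgroup.index_map_eq _ hπs hker]
  exact natCard_quotient_range_mulVecLin_eq_natAbs_det A hdet

/-- An invertible change of coordinates does not change the order of the kernel: `#ker(A R) = #ker A` for `R`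
a unit (bijection `c ↦ R c`) — the passage from `ker γ̄` to the Hecke kernel `ker(γ̄ R′)`.
[cite: ShimuraIATAF1971, §3.2] -/
theorem natCard_ker_mulVec_mul_eq_of_isUnit {S : Type*} [CommRing S] (A : Matrix ι ι S) {R : Matrix ι ι S}
    (hR : IsUnit R) :
    Nat.card {c : ι → S // (A * R) *ᵥ c = 0} = Nat.card {c : ι → S // A *ᵥ c = 0} := by
  obtain ⟨u, rfl⟩ := hR
  refine Nat.card_congr
    { toFun := fun c => ⟨(u : Matrix ι ι S) *ᵥ c.1, by rw [Matrix.mulVec_mulVec]; exact c.2⟩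
      invFun := fun c => ⟨((u⁻¹ : (Matrix ι ι S)ˣ) : Matrix ι ι S) *ᵥ c.1, by
        rw [Matrix.mulVec_mulVec, Matrix.mul_assoc, Units.mul_inv, Matrix.mul_one]; exact c.2⟩
      left_inv := fun c => Subtype.ext (by
        change ((u⁻¹ : (Matrix ι ι S)ˣ) : Matrix ι ι S) *ᵥ ((u : Matrix ι ι S) *ᵥ c.1) = c.1
        rw [Matrix.mulVec_mulVec, Units.inv_mul, Matrix.one_mulVec])
      right_inv := fun c => Subtype.ext (by
        change (u : Matrix ι ι S) *ᵥ (((u⁻¹ : (Matrix ι ι S)ˣ) : Matrix ι ι S) *ᵥ c.1) = c.1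
        rw [Matrix.mulVec_mulVec, Units.mul_inv, Matrix.one_mulVec]) }

/-- **`#{c ∈ (ℤ/M)^ι : (Ā R) c = 0} = |det A|`** for `A B = M·1` integral and `R ∈ GL_ι(ℤ/M)` — the shape of the
Hecke kernel `ker(γ̄ · R′)` with `R′` the residue of an adelic representative. [cite: StacksProject, Tag 02QE]
[cite: ShimuraIATAF1971, §3.2] -/
theorem natCard_ker_mulVec_mul_zmod_eq_natAbs_det {M : ℕ} [NeZero M] (A B : Matrix ι ι ℤ)
    (hAB : A * B = (M : ℤ) • (1 : Matrix ι ι ℤ)) {R : Matrix ι ι (ZMod M)} (hR : IsUnit R) :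
    Nat.card {c : ι → ZMod M // (A.map (Int.castRingHom (ZMod M)) * R) *ᵥ c = 0} = A.det.natAbs := by
  rw [natCard_ker_mulVec_mul_eq_of_isUnit _ hR, natCard_ker_mulVec_zmod_eq_natAbs_det A B hAB]

end Literature.LinearAlgebra.FreeModule
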